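import Mathlib
import Summits.Ventures.PercRepro2.Defs
import Summits.Ventures.PercRepro2.Graph
import Summits.Ventures.PercRepro2.OneColourSwitch
import Summits.Ventures.PercRepro2.RegionHubSign
import Summits.Ventures.PercRepro2.SideSwitch
import Summits.Ventures.PercRepro2.SideSwitchClosed
import Summits.Ventures.PercRepro2.M9NoPocketDefs
import Summits.Ventures.PercRepro2.M9NoPocketWorld
import Summits.Ventures.PercRepro2.M9NoPocketWorldD
import Summits.Ventures.PercRepro2.M9NoPocketFibre
import Summits.Ventures.PercRepro2.M9SubcubeHarris
import Summits.Ventures.PercRepro2.M9ClusterFibreHarris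
import Summits.Ventures.PercRepro2.M9PocketUnitFibre
import Summits.Ventures.PercRepro2.M9PocketUnitFibreSum
import Summits.Ventures.PercRepro2.M9PocketPsi2
import Summits.Ventures.PercRepro2.M9PocketPsi2Sign
import Summits.Ventures.PercRepro2.M9PocketProdPoint
import Summits.Ventures.PercRepro2.M9PocketProdWorlds
import Summits.Ventures.PercRepro2.M9PocketProdMono
import Summits.Ventures.PercRepro2.M9GeneralDSplit
import Summits.Ventures.PercRepro2.M9GeneralDHD

/-!
# The product fibre of a skeleton: the `W`-defect is antitone (blind cell PercRepro2, p3 g39,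
2026-08-29; `proofs/P3-POCKETRK.md` §8′ (iii) and §10 (d): the free-block extension, part 4)

On the product fibre of a skeleton `ρ`, the `Y`-world of `{r, s}` shrinks with the index
(`K2_prod_anti`: a `Y`-path from `r` at `φ S'` uses only fixed edges and edges at blocks of
`S`) and the `W`-cluster of `d` shrinks with the index (`cluster_compl_d_prod_anti`: a
`W`-path from `d` never enters a switched block or `r, s`; its free edges stay closed at the
smaller index).  Hence the `W`-defect «`d ~_W p`, `d ~_W q`, or `d ~_W x` for some `x ∈ K₂ ∖
{r, s, d}`» — the `HD` condition on a `K`-only point — is ANTITONE in the index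
(`wdefect_prod_anti`): the dead and dirty points of the fibre form a lower set.  Own work;
std axioms.
-/

namespace Summit.Ventures.PercRepro2

namespace NoPocket

open Finset Classical OneColourSwitch SideSwitch

variable {V : Type*} {E : Type*} {ends : E → Sym2 V} {p q r s d : V} {ρ : Config E}
  {𝔉 : Finset (Finset V)} {R : Finset E}

section Anti

variable (hdr : d ≠ r) (hds : d ≠ s) (hrs : within ends ({r, s} : Set V) = ∅)
  (hT : ∀ e, ends e ≠ s(d, r) ∧ ends e ≠ s(d, s))
  (hsep : sep2 ends p q r s ρ) (hD : DOne ends r s d ρ) (hK : d ∈ K2 ends r s ρ)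
  (hB : ∀ x ∈ M2 (endsD ends d) r s ρ, x = r ∨ x = s)
  (hR : ∀ e, e ∈ R ↔ e ∉ touches ends (cluster ends ρ d ∪ K2 (endsD ends d) r s ρ ∪
    M2 (endsD ends d) r s ρ))
  (h𝔉K : ∀ C ∈ 𝔉, (↑C : Set V) ⊆ K2 (endsD ends d) r s ρ)
  (h𝔉r : ∀ C ∈ 𝔉, r ∉ C) (h𝔉s : ∀ C ∈ 𝔉, s ∉ C)
  (h𝔉cl : ∀ C ∈ 𝔉, ClosedIn (endsD ends d) (sided (endsD ends d) r s ρ) (↑C : Set V))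
  (h𝔉d : ∀ C ∈ 𝔉, ∀ e y, y ∈ C → ends e ≠ s(d, y))
  (h𝔉pk : ∀ C ∈ 𝔉, ∀ e x y, ends e = s(x, y) → x ∈ C → y ∈ cluster ends ρ d →
    y ∈ C ∨ y = r ∨ y = s)
  {S S' : Finset ({C // C ∈ 𝔉} ⊕ {e // e ∈ R})} (hSS : S ⊆ S')

include hdr hds hrs hT hsep hD hK hB hR h𝔉K h𝔉r h𝔉s h𝔉cl h𝔉d h𝔉pk hSS in
/-- **The `Y`-world of `{r, s}` shrinks with the index.** -/
lemma K2_prod_anti :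
    K2 ends r s (flipTouch (endsD ends d)
      {x : V | ∃ c : {C // C ∈ 𝔉}, Sum.inl c ∈ S' ∧ x ∈ c.1}
      (fun e => if h : e ∈ R then decide (Sum.inr ⟨e, h⟩ ∈ S') else ρ e)) ⊆
    K2 ends r s (flipTouch (endsD ends d)
      {x : V | ∃ c : {C // C ∈ 𝔉}, Sum.inl c ∈ S ∧ x ∈ c.1}
      (fun e => if h : e ∈ R then decide (Sum.inr ⟨e, h⟩ ∈ S) else ρ e)) := by
  set Sw := {x : V | ∃ c : {C // C ∈ 𝔉}, Sum.inl c ∈ S ∧ x ∈ c.1} with hSw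
  set Sw' := {x : V | ∃ c : {C // C ∈ 𝔉}, Sum.inl c ∈ S' ∧ x ∈ c.1} with hSw'
  set ω := flipTouch (endsD ends d) Sw
    (fun e => if h : e ∈ R then decide (Sum.inr ⟨e, h⟩ ∈ S) else ρ e) with hω
  set ω' := flipTouch (endsD ends d) Sw'
    (fun e => if h : e ∈ R then decide (Sum.inr ⟨e, h⟩ ∈ S') else ρ e) with hω'
  have hZ := K2_prod_subset hdr hds hrs hT hsep hD hB hR h𝔉K h𝔉r h𝔉s h𝔉cl h𝔉d h𝔉pk S'
  have hSwK' := switched_subset_K2 (ρ := ρ) (r := r) (s := s) (d := d) (R := R) h𝔉K S'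
  intro x hx
  have key : ∀ t, (t = r ∨ t = s) → Conn ends ω' t x → Conn ends ω t x := by
    intro t ht hc
    have hmem : x ∈ {z | Conn ends ω' t z ∧ Conn ends ω t z} := by
      refine mem_of_conn_of_closed ?_ ⟨conn_refl _ _ _, conn_refl _ _ _⟩ hc
      rintro a ⟨hac', hac⟩ b hab
      obtain ⟨hne, e, he, hends⟩ := openGraph_adj.1 hab
      refine ⟨conn_trans hac' (conn_of_openAdj ⟨e, he, hends⟩),
        conn_trans hac (conn_of_openAdj ⟨e, ?_, hends⟩)⟩
      -- `a` is in the `Y`-world of `ω'`, hence in `Z(S')`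
      have haK' : a ∈ K2 ends r s ω' := by
        rcases ht with rfl | rfl
        · exact mem_K2_iff.2 (Or.inl hac')
        · exact mem_K2_iff.2 (Or.inr hac')
      have haZ := hZ haK'
      simp only [Set.mem_setOf_eq] at haZ
      -- `a ∈ U` and `a ∉ Sw'`
      have haU : a ∈ cluster ends ρ d ∪ K2 (endsD ends d) r s ρ ∪ M2 (endsD ends d) r s ρ := by
        rcases haZ with ⟨h1, _⟩ | h1 | ⟨h1, _, _⟩
        · exact Or.inl (Or.inr h1)
        · exact Or.inl (Or.inl (h1 ▸ mem_cluster_self ends ρ d))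
        · exact Or.inl (Or.inl h1)
      have haSw' : a ∉ Sw' := by
        rcases haZ with ⟨_, h1⟩ | h1 | ⟨_, h1, _⟩
        · exact h1
        · intro h2; exact not_mem_K2_endsD hdr hds ρ (h1 ▸ hSwK' h2)
        · intro h2; exact h1 (hSwK' h2)
      have hnR : e ∉ R := fun h' => (hR e).1 h' ⟨a, haU, b, hends⟩
      by_cases hbSw : b ∈ Sw
      · -- the edge touches a block of `S`: flipped in both colourings
        have hbK : b ∈ K2 (endsD ends d) r s ρ := switched_subset_K2 h𝔉K S hbSw
        have hbd : b ≠ d := by rintro rfl; exact not_mem_K2_endsD hdr hds ρ hbK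
        have had : a ≠ d := by
          rintro rfl
          obtain ⟨c, _, hbc⟩ := hbSw
          exact h𝔉d c.1 c.2 e b hbc hends
        have hde : d ∉ ends e := notMem_of_ends_ne hends had hbd
        have ht : e ∈ touches (endsD ends d) Sw :=
          ⟨b, hbSw, a, by rw [endsD_of_notMem hde, hends, Sym2.eq_swap]⟩
        have ht' : e ∈ touches (endsD ends d) Sw' :=
          ⟨b, ⟨hbSw.choose, hSS hbSw.choose_spec.1, hbSw.choose_spec.2⟩, a,
            by rw [endsD_of_notMem hde, hends, Sym2.eq_swap]⟩
        rw [hω, prod_eq_of_touches S hnR ht]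
        rw [hω', prod_eq_of_touches S' hnR ht'] at he
        exact he
      · by_cases hbSw' : b ∈ Sw'
        · -- the edge enters a block of `S' ∖ S` from `Z(S')`: impossible
          exfalso
          obtain ⟨c, hcS', hbc⟩ := hbSw'
          have hbK : b ∈ K2 (endsD ends d) r s ρ := hSwK' ⟨c, hcS', hbc⟩
          have hbd : b ≠ d := by rintro rfl; exact not_mem_K2_endsD hdr hds ρ hbK
          have had : a ≠ d := by rintro rfl; exact h𝔉d c.1 c.2 e b hbc hends
          have hde : d ∉ ends e := notMem_of_ends_ne hends had hbd
          have ht' : e ∈ touches (endsD ends d) Sw' :=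
            ⟨b, ⟨c, hcS', hbc⟩, a, by rw [endsD_of_notMem hde, hends, Sym2.eq_swap]⟩
          rw [hω', prod_eq_of_touches S' hnR ht'] at he
          have hρe : ρ e = false := by
            cases h' : ρ e
            · rfl
            · rw [h'] at he; exact absurd he (by decide)
          -- `a` is `r, s`, a sided vertex, or in the cluster: each case is impossible
          rcases haZ with ⟨haK, _⟩ | h1 | ⟨haC, haK, _⟩
          · by_cases hars : a = r ∨ a = s
            · have haM : a ∈ M2 (endsD ends d) r s ρ := by
                rcases hars with rfl | rfl
                · exact r_mem_M2 a s ρ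
                · exact s_mem_M2 r a ρ
              have hbM := mem_M2_of_closed haM hρe (by rw [endsD_of_notMem hde, hends])
              rcases hB b hbM with hb | hb
              · exact h𝔉r c.1 c.2 (hb ▸ hbc)
              · exact h𝔉s c.1 c.2 (hb ▸ hbc)
            · exact haSw' ⟨c, hcS', Finset.mem_coe.1 (h𝔉cl c.1 c.2 e b a
                (by rw [endsD_of_notMem hde, hends, Sym2.eq_swap]) (Finset.mem_coe.2 hbc)
                ⟨Or.inl haK, fun h' => hars (Or.inl h'), fun h' => hars (Or.inr h')⟩)⟩
          · exact had h1
          · rcases h𝔉pk c.1 c.2 e b a (by rw [hends, Sym2.eq_swap]) hbc haC with h' | h' | h'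
            · exact haK (hSwK' ⟨c, hcS', h'⟩)
            · exact haK (by rw [h']; exact r_mem_K2 r s ρ)
            · exact haK (by rw [h']; exact s_mem_K2 r s ρ)
        · -- a fixed edge
          have hnt : e ∉ touches (endsD ends d) Sw := by
            rintro ⟨z, hz, w, hzw⟩
            have hzK := switched_subset_K2 h𝔉K S hz
            have hzd : z ≠ d := by rintro rfl; exact not_mem_K2_endsD hdr hds ρ hzK
            have hde : d ∉ ends e := by
              intro hde
              rw [endsD_of_mem hde, Sym2.eq_iff] at hzw
              rcases hzw with ⟨h1, _⟩ | ⟨_, h1⟩ <;> exact hzd h1.symm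
            rw [endsD_of_notMem hde, hends, Sym2.eq_iff] at hzw
            rcases hzw with ⟨h1, _⟩ | ⟨_, h1⟩
            · exact haSw' (h1 ▸ ⟨hz.choose, hSS hz.choose_spec.1, hz.choose_spec.2⟩)
            · exact hbSw (h1 ▸ hz)
          have hnt' : e ∉ touches (endsD ends d) Sw' := by
            rintro ⟨z, hz, w, hzw⟩
            have hzK := hSwK' hz
            have hzd : z ≠ d := by rintro rfl; exact not_mem_K2_endsD hdr hds ρ hzK
            have hde : d ∉ ends e := by
              intro hde
              rw [endsD_of_mem hde, Sym2.eq_iff] at hzw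
              rcases hzw with ⟨h1, _⟩ | ⟨_, h1⟩ <;> exact hzd h1.symm
            rw [endsD_of_notMem hde, hends, Sym2.eq_iff] at hzw
            rcases hzw with ⟨h1, _⟩ | ⟨_, h1⟩
            · exact haSw' (h1 ▸ hz)
            · exact hbSw' (h1 ▸ hz)
          rw [hω, prod_eq_fixed S hnR hnt]
          rw [hω', prod_eq_fixed S' hnR hnt'] at he
          exact he
    exact hmem.2
  rcases mem_K2_iff.1 hx with hc | hc
  · exact mem_K2_iff.2 (Or.inl (key r (Or.inl rfl) hc))
  · exact mem_K2_iff.2 (Or.inr (key s (Or.inr rfl) hc))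

include hdr hds hrs hT hsep hD hK hB hR h𝔉K h𝔉r h𝔉s h𝔉cl h𝔉d h𝔉pk hSS in
/-- **The `W`-cluster of `d` shrinks with the index**: a `W`-path from `d` never enters a
switched block or `r, s`; its free edges are closed at the smaller index too, its other edges
are fixed or touch a block switched at both indices. -/
lemma cluster_compl_d_prod_anti :
    cluster ends (OneColourSwitch.compl (flipTouch (endsD ends d)
      {x : V | ∃ c : {C // C ∈ 𝔉}, Sum.inl c ∈ S' ∧ x ∈ c.1}
      (fun e => if h : e ∈ R then decide (Sum.inr ⟨e, h⟩ ∈ S') else ρ e))) d ⊆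
    cluster ends (OneColourSwitch.compl (flipTouch (endsD ends d)
      {x : V | ∃ c : {C // C ∈ 𝔉}, Sum.inl c ∈ S ∧ x ∈ c.1}
      (fun e => if h : e ∈ R then decide (Sum.inr ⟨e, h⟩ ∈ S) else ρ e))) d := by
  set Sw := {x : V | ∃ c : {C // C ∈ 𝔉}, Sum.inl c ∈ S ∧ x ∈ c.1} with hSw
  set Sw' := {x : V | ∃ c : {C // C ∈ 𝔉}, Sum.inl c ∈ S' ∧ x ∈ c.1} with hSw'
  set ω := flipTouch (endsD ends d) Sw
    (fun e => if h : e ∈ R then decide (Sum.inr ⟨e, h⟩ ∈ S) else ρ e) with hω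
  set ω' := flipTouch (endsD ends d) Sw'
    (fun e => if h : e ∈ R then decide (Sum.inr ⟨e, h⟩ ∈ S') else ρ e) with hω'
  have hSwK' := switched_subset_K2 (ρ := ρ) (r := r) (s := s) (d := d) (R := R) h𝔉K S'
  have hdM' := d_notMem_M2_prod hdr hds hrs hT hsep hB hR h𝔉K h𝔉r h𝔉s h𝔉cl h𝔉d S'
  intro x hx
  have key : x ∈ {z | Conn ends (OneColourSwitch.compl ω') d z ∧
      Conn ends (OneColourSwitch.compl ω) d z ∧ z ∉ Sw' ∧ z ≠ r ∧ z ≠ s} := by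
    refine mem_of_conn_of_closed ?_ ⟨conn_refl _ _ _, conn_refl _ _ _,
      fun h => not_mem_K2_endsD hdr hds ρ (hSwK' h), hdr, hds⟩ hx
    rintro a ⟨hac', hac, haSw', har, has⟩ b hab
    obtain ⟨hne, e, he, hends⟩ := openGraph_adj.1 hab
    have hac'' : Conn ends (OneColourSwitch.compl ω') d b :=
      conn_trans hac' (conn_of_openAdj ⟨e, he, hends⟩)
    -- `b` is not `r` or `s` (`d` is not `W`-reached)
    have hbrs : ¬ (b = r ∨ b = s) := by
      intro hb
      apply hdM'
      rcases hb with rfl | rfl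
      · exact mem_M2_iff.2 (Or.inl (conn_symm hac''))
      · exact mem_M2_iff.2 (Or.inr (conn_symm hac''))
    have he' : ω' e = false := by
      simp only [OneColourSwitch.compl, Bool.not_eq_true'] at he; exact he
    -- `b` is not in a block of `S'`: the edge would be flipped, hence `Y` at `ρ`, which is
    -- impossible from `a`
    have hbSw' : b ∉ Sw' := by
      rintro ⟨c, hcS', hbc⟩
      have hbK : b ∈ K2 (endsD ends d) r s ρ := hSwK' ⟨c, hcS', hbc⟩
      have hbd : b ≠ d := by rintro rfl; exact not_mem_K2_endsD hdr hds ρ hbK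
      have had : a ≠ d := by rintro rfl; exact h𝔉d c.1 c.2 e b hbc hends
      have hde : d ∉ ends e := notMem_of_ends_ne hends had hbd
      have hnR : e ∉ R := fun h' => (hR e).1 h' ⟨b, Or.inl (Or.inr hbK), a, by rw [hends, Sym2.eq_swap]⟩
      have ht' : e ∈ touches (endsD ends d) Sw' :=
        ⟨b, ⟨c, hcS', hbc⟩, a, by rw [endsD_of_notMem hde, hends, Sym2.eq_swap]⟩
      rw [hω', prod_eq_of_touches S' hnR ht'] at he'
      have hρe : ρ e = true := by
        cases h' : ρ e
        · rw [h'] at he'; exact absurd he' (by decide)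
        · rfl
      -- a `Y` edge at `ρ` from `a ∉ Sw' ∪ {r, s}` into the block `c`
      by_cases haK : a ∈ K2 (endsD ends d) r s ρ
      · exact haSw' ⟨c, hcS', Finset.mem_coe.1 (h𝔉cl c.1 c.2 e b a
          (by rw [endsD_of_notMem hde, hends, Sym2.eq_swap]) (Finset.mem_coe.2 hbc)
          ⟨Or.inl haK, har, has⟩)⟩
      · exact haK (mem_K2_of_open hbK hρe (by rw [endsD_of_notMem hde, hends, Sym2.eq_swap]))
    refine ⟨hac'', conn_trans hac (conn_of_openAdj ⟨e, ?_, hends⟩), hbSw',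
      fun h => hbrs (Or.inl h), fun h => hbrs (Or.inr h)⟩
    -- the colour at `ω`: a free edge, an edge at a block of `S`, or a fixed edge
    simp only [OneColourSwitch.compl, Bool.not_eq_true']
    by_cases heR : e ∈ R
    · have hnt := notMem_touches_switched_of_mem_R hdr hds hR h𝔉K S heR
      have hnt' := notMem_touches_switched_of_mem_R hdr hds hR h𝔉K S' heR
      rw [hω', prod_eq_of_mem_R S' heR hnt'] at he'
      rw [hω, prod_eq_of_mem_R S heR hnt]
      simp only [decide_eq_false_iff_not] at he' ⊢
      exact fun h => he' (hSS h)
    · have hnt' : e ∉ touches (endsD ends d) Sw' := by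
        rintro ⟨z, hz, w, hzw⟩
        have hzK := hSwK' hz
        have hzd : z ≠ d := by rintro rfl; exact not_mem_K2_endsD hdr hds ρ hzK
        have hde : d ∉ ends e := by
          intro hde
          rw [endsD_of_mem hde, Sym2.eq_iff] at hzw
          rcases hzw with ⟨h1, _⟩ | ⟨_, h1⟩ <;> exact hzd h1.symm
        rw [endsD_of_notMem hde, hends, Sym2.eq_iff] at hzw
        rcases hzw with ⟨h1, _⟩ | ⟨_, h1⟩
        · exact haSw' (h1 ▸ hz)
        · exact hbSw' (h1 ▸ hz)
      have hnt : e ∉ touches (endsD ends d) Sw := fun h =>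
        hnt' (by
          obtain ⟨z, hz, w, hzw⟩ := h
          exact ⟨z, ⟨hz.choose, hSS hz.choose_spec.1, hz.choose_spec.2⟩, w, hzw⟩)
      rw [hω', prod_eq_fixed S' heR hnt'] at he'
      rw [hω, prod_eq_fixed S heR hnt]
      exact he'
  exact key.2.1

include hdr hds hrs hT hsep hD hK hB hR h𝔉K h𝔉r h𝔉s h𝔉cl h𝔉d h𝔉pk hSS in
/-- **The `W`-defect is antitone in the index**: the dead and dirty points of the product fibre
form a lower set. -/
lemma wdefect_prod_anti
    (h : WDefect ends p q r s d (flipTouch (endsD ends d)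
      {x : V | ∃ c : {C // C ∈ 𝔉}, Sum.inl c ∈ S' ∧ x ∈ c.1}
      (fun e => if h : e ∈ R then decide (Sum.inr ⟨e, h⟩ ∈ S') else ρ e))) :
    WDefect ends p q r s d (flipTouch (endsD ends d)
      {x : V | ∃ c : {C // C ∈ 𝔉}, Sum.inl c ∈ S ∧ x ∈ c.1}
      (fun e => if h : e ∈ R then decide (Sum.inr ⟨e, h⟩ ∈ S) else ρ e)) := by
  have hW := cluster_compl_d_prod_anti hdr hds hrs hT hsep hD hK hB hR h𝔉K h𝔉r h𝔉s h𝔉cl h𝔉d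
    h𝔉pk hSS
  have hK2 := K2_prod_anti hdr hds hrs hT hsep hD hK hB hR h𝔉K h𝔉r h𝔉s h𝔉cl h𝔉d h𝔉pk hSS
  rcases h with h | h | ⟨x, hxr, hxs, hxd, hxK, hxc⟩
  · exact Or.inl (hW h)
  · exact Or.inr (Or.inl (hW h))
  · exact Or.inr (Or.inr ⟨x, hxr, hxs, hxd, hK2 hxK, hW hxc⟩)

end Anti

end NoPocket

end Summit.Ventures.PercRepro2
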